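import Summits.KontsevichZagierPeriods.KontsevichZagierPeriods.Statement
import Summits.KontsevichZagierPeriods.KontsevichZagierPeriods.Theses.CoactionDevissage
import Summits.KontsevichZagierPeriods.KontsevichZagierPeriods.Theorems.FurushoPentagonSectorToKernelCubeResolutionOfNash

/-!
# Birth skeleton — piece X₁ `CubeResolution` of the split of `RationalKernel` (stmt-KontsevichZagierPeriods-3165, route CoactionDevissage)

Crux-strategist RESTATED re-audit r1 of the deciding crux `RationalKernel`; the piece is the hub-wide item
stmt-KontsevichZagierPeriods-17978 (shared with HermiteRigidity's split of `ReductionRigidity` and with stub S1 of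
FurushoPentagon.SectorToKernel / S1b of ReducedPeriodRing), and this skeleton is its registered birth skeleton
transported verbatim to this crux's workfiles.  `CubeResolution` (every integral representation is congruent modulo
`KZ.relations` to a `ℤ`-combination of TAME CUBE classes) from two genuine stubs and the tree:

* `stub_nashCellReduction` (M/L — cylindrical decomposition + Nash parametrisation of cells, rules (1a)+(2);
  no resolution of singularities): a BOUNDED VOLUME class `[K, 1]` is congruent modulo relations to a
  `ℤ`-combination of OPEN-CUBE NASH classes `[(0,1)ᵐ, J]` of the same dimension (`J` real analytic on the
  open cube — automatically `ℚ`-semialgebraic and integrable there, being the data of an `IntegralRep`;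
  typically `J = |det Φ'|` of the cell chart, singular at the boundary);
* `stub_openCubeNashResolution` (XL — THE HARD STUB: embedded resolution / rectilinearisation of the
  boundary singularities of a Nash integrand as rule-(2) moves on open pieces, blow-up charts and power
  substitutions `t = τᴺ`, integrability forcing the boundary exponents `≥ 0` after `τᴺ`; Hironaka 1964,
  Bierstone–Milman 1988 §4, Parusiński 1994; the one-variable rung is landed: `cubeResolution_dimLEOne`,
  `FurushoPentagonSectorToKernel{PuiseuxRight,TameAfterPowerSubst,PieceToTameCube,AnalyticPieceResolves}`):
  an open-cube Nash class is congruent modulo relations to an element of the tame cubical span;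
* tree: `cubeResolution_of_boundedVolumes` (Viu-Sos' semi-canonical reduction `KZ.exists_sub_isBounded`,
  PROVED: every representation is `≡ [A] − [B]`, `A`, `B` bounded volumes one dimension up).

`CubeResolution_of : stub_nashCellReduction → stub_openCubeNashResolution → CubeResolution` is proved below
(closure induction transporting the open-cube Nash span into the tame span, then Viu-Sos).
-/

-- adapted from Cruxes/ReductionRigidity/SplitR1CubeResolutionBirth.lean (planner-cstrat-stmt-KontsevichZagierPeriods-3407-r1-0)
noncomputable section

-- `Summit.KontsevichZagierPeriods.KontsevichZagierPeriods.…` is the tree's mandated layout (single-conjunct summit).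
set_option linter.dupNamespace false

namespace Summit.KontsevichZagierPeriods.KontsevichZagierPeriods.Cruxes.RationalKernel.CubeResolutionBirth

open Set MeasureTheory
open Literature.NumberTheory.Transcendental
open Literature.NumberTheory.Transcendental.KZ hiding cubicalSpan
open Summit.KontsevichZagierPeriods.FurushoPentagon.ReducedPeriodRing (unitCube cubicalGens cubicalSpan)
open Summit.KontsevichZagierPeriods.FurushoPentagon.SectorToKernel (cubeResolution_of_boundedVolumes)

/-- X₁ — CUBE RESOLUTION, verbatim the child `CubeResolution` of the split (import-free cube). -/
def CubeResolution : Prop :=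
  ∀ (N : ℕ) (u : Literature.NumberTheory.Transcendental.KZ.IntegralRep N), ∃ c ∈ AddSubgroup.closure {d : Literature.NumberTheory.Transcendental.KZ.FormalRep | ∃ (n : ℕ) (r : Literature.NumberTheory.Transcendental.KZ.IntegralRep n), r.domain = {x : Fin n → ℝ | ∀ i, 0 ≤ x i ∧ x i ≤ 1} ∧ AnalyticOnNhd ℝ r.integrand {x : Fin n → ℝ | ∀ i, 0 ≤ x i ∧ x i ≤ 1} ∧ d = Literature.NumberTheory.Transcendental.KZ.of r}, Literature.NumberTheory.Transcendental.KZ.of u - c ∈ Literature.NumberTheory.Transcendental.KZ.relations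

/-- The OPEN-CUBE NASH classes of dimension `m`: `[(0,1)ᵐ, J]`, `J` real analytic on the open cube. -/
def openCubeNashGens (m : ℕ) : Set FormalRep :=
  {d | ∃ v : IntegralRep m, v.domain = {x : Fin m → ℝ | ∀ i, 0 < x i ∧ x i < 1} ∧
    AnalyticOnNhd ℝ v.integrand {x : Fin m → ℝ | ∀ i, 0 < x i ∧ x i < 1} ∧ d = of v}

/-- STUB (M/L) — **bounded volumes reduce to open-cube Nash classes of the same dimension** (cell
decomposition of the bounded `ℚ`-semialgebraic solid `K`, rule (1a) across the null walls, and the Nash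
chart of each open cell onto `(0,1)ᵐ`, rule (2), Jacobian `|det Φ'|`; cells of lower dimension are null).
Landed for `m ≤ 2` in substance (`LiftingCriteriaCubeNashNormalForm{VolumeTwo,Cells,HalfCell}`).
[cite: KontsevichZagier2001, §1.2 rules (1),(2)] [cite: BochnakCosteRoy1998, Thm. 2.3.6, Prop. 2.9.10] -/
theorem stub_nashCellReduction : ∀ (m : ℕ) (K : IntegralRep m), Bornology.IsBounded K.domain →
    (∀ x ∈ K.domain, K.integrand x = 1) →
    ∃ c ∈ AddSubgroup.closure (openCubeNashGens m), of K - c ∈ relations := by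
  sorry

/-- STUB (XL, hardest) — **resolution of an open-cube Nash integrand into the tame cubical span**
(embedded resolution / rectilinearisation of the boundary singularities of `J` by finitely many
`ℚ`-semialgebraic blow-up charts and power substitutions, each ONE rule-(2) instance on an open piece,
null walls by rule (1a); absolute integrability forces the boundary exponents after `τᴺ` to be `≥ 0`, so
each pulled-back integrand is analytic up to the closed cube).  The statement to import from real-analytic
geometry is Hironaka's rectilinearisation / Bierstone–Milman's uniformization for the Nash function `J`
together with the cell charts' Jacobians. [cite: Hironaka1964] [cite: BierstoneMilman1988, §4–5]
[cite: HuberMullerStachPeriods2017, Lemma 12.2.2] -/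
theorem stub_openCubeNashResolution : ∀ (m : ℕ) (v : IntegralRep m),
    v.domain = {x : Fin m → ℝ | ∀ i, 0 < x i ∧ x i < 1} →
    AnalyticOnNhd ℝ v.integrand {x : Fin m → ℝ | ∀ i, 0 < x i ∧ x i < 1} →
    ∃ c ∈ AddSubgroup.closure {d : FormalRep | ∃ (n : ℕ) (r : IntegralRep n),
      r.domain = {x : Fin n → ℝ | ∀ i, 0 ≤ x i ∧ x i ≤ 1} ∧
      AnalyticOnNhd ℝ r.integrand {x : Fin n → ℝ | ∀ i, 0 ≤ x i ∧ x i ≤ 1} ∧ d = of r},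
      of v - c ∈ relations := by
  sorry

/-- Closure induction: if every generator of `S` is congruent modulo relations to an element of the
subgroup `T`, so is every element of `closure S`. [folklore] -/
theorem closure_reduces {S : Set FormalRep} {T : AddSubgroup FormalRep}
    (h : ∀ s ∈ S, ∃ t ∈ T, s - t ∈ relations) :
    ∀ c ∈ AddSubgroup.closure S, ∃ t ∈ T, c - t ∈ relations := by
  intro c hc
  induction hc using AddSubgroup.closure_induction with
  | mem x hx => exact h x hx
  | zero => exact ⟨0, T.zero_mem, by simp⟩
  | add x y _ _ hx hy =>
    obtain ⟨a, ha, hxa⟩ := hx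
    obtain ⟨b, hb, hyb⟩ := hy
    refine ⟨a + b, T.add_mem ha hb, ?_⟩
    have : x + y - (a + b) = (x - a) + (y - b) := by abel
    rw [this]
    exact relations.add_mem hxa hyb
  | neg x _ hx =>
    obtain ⟨a, ha, hxa⟩ := hx
    refine ⟨-a, T.neg_mem ha, ?_⟩
    have : -x - -a = -(x - a) := by abel
    rw [this]
    exact relations.neg_mem hxa

/-- **X₁ from its two stubs**: bounded volumes → open-cube Nash span (stub 1) → tame cubical span (stub 2,
generator by generator, `closure_reduces`) → every representation (Viu-Sos, `cubeResolution_of_boundedVolumes`,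
landed).  The conclusion is the child `CubeResolution` BY NAME. [cite: ViuSos2021, Thm. 1.1] [folklore] -/
theorem CubeResolution_of :
    (∀ (m : ℕ) (K : IntegralRep m), Bornology.IsBounded K.domain → (∀ x ∈ K.domain, K.integrand x = 1) →
      ∃ c ∈ AddSubgroup.closure (openCubeNashGens m), of K - c ∈ relations) →
    (∀ (m : ℕ) (v : IntegralRep m), v.domain = {x : Fin m → ℝ | ∀ i, 0 < x i ∧ x i < 1} →
      AnalyticOnNhd ℝ v.integrand {x : Fin m → ℝ | ∀ i, 0 < x i ∧ x i < 1} →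
      ∃ c ∈ AddSubgroup.closure {d : FormalRep | ∃ (n : ℕ) (r : IntegralRep n),
        r.domain = {x : Fin n → ℝ | ∀ i, 0 ≤ x i ∧ x i ≤ 1} ∧
        AnalyticOnNhd ℝ r.integrand {x : Fin n → ℝ | ∀ i, 0 ≤ x i ∧ x i ≤ 1} ∧ d = of r},
        of v - c ∈ relations) →
    CubeResolution := by
  intro hcell hres
  -- the tame cubical span, as the tree's `cubicalSpan` (definitionally the import-free closure)
  have hvol : ∀ (m : ℕ) (K : IntegralRep m), Bornology.IsBounded K.domain →
      (∀ x ∈ K.domain, K.integrand x = 1) → ∃ c : FormalRep, c ∈ cubicalSpan ∧ of K - c ∈ relations := by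
    intro m K hb h1
    obtain ⟨c₁, hc₁, hK⟩ := hcell m K hb h1
    have hgen : ∀ s ∈ openCubeNashGens m, ∃ t ∈ cubicalSpan, s - t ∈ relations := by
      rintro s ⟨v, hvd, hva, rfl⟩
      obtain ⟨t, ht, hvt⟩ := hres m v hvd hva
      exact ⟨t, ht, hvt⟩
    obtain ⟨c₂, hc₂, h₁₂⟩ := closure_reduces hgen c₁ hc₁
    refine ⟨c₂, hc₂, ?_⟩
    have : of K - c₂ = (of K - c₁) + (c₁ - c₂) := by abel
    rw [this]
    exact relations.add_mem hK h₁₂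
  intro N u
  obtain ⟨c, hc, huc⟩ := cubeResolution_of_boundedVolumes hvol N u
  exact ⟨c, hc, huc⟩

end Summit.KontsevichZagierPeriods.KontsevichZagierPeriods.Cruxes.RationalKernel.CubeResolutionBirth
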